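import Summits.QuantumFields.GaugeBoot.OrbitAverages
import Summits.QuantumFields.GaugeBoot.WordLoop
import HarnessLib

/-!
# Gauge-boot: the torus loop variable of a lattice word and its symmetries (shared toolkit)

Cell `pub-gaugeboot` (HOME `run/shared/lean/pub/pub-gaugeboot/`), seat lean1; companion of `LatticeWords`
(the word layer, seat lean2) and `Targets` (the statement layer).

HONEST FRAMING (page 1 of every file of this cell): certified bounds on lattice expectations at
STATED coupling, gauge group, dimension and torus size; NOT a mass gap, NOT a continuum limit,
NOT a string tension, NOT large `N`. The venture is explicitly NOT Yang–Mills-summit-bearing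
(barriers `FixedCouplingUltralocality`, `PerturbativeInvisibility`).

## Content

The SDP variables of a lattice bootstrap certificate are torus expectations of the loop variable
`wordLoop ρ x w U = (1/N) Re tr ρ(hol_x(w)(U))` (`WordLoop`) of a closed lattice word `w` read from a base
point `x` (`wordHolonomy` of `LatticeWords`). Both the loop-equation rows (task L1) and the Gram / reflection blocks
(F4) are written over RAW words; the certificate lives on CANONICAL loop classes (words modulo the
lattice symmetries, cyclic rotation, reversal and backtracks). This file proves that the torus Wilson
state does not see the difference:

* equivariance of `wordHolonomy` under torus translations (`torusConfigShift`), axis permutations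
  (`configPerm`, with `Step.permute`) and the site reflection `x₀ ↦ -x₀` (`GaugeConfig.negReflect`, with
  `Step.reflect0`);
* invariance of `⟨wordLoop⟩_β` (loop variable of `WordLoop`) under: translation of the base point,
  axis permutations, the reflection (every torus side `L`, `wilsonExpectation_comp_negReflect` of
  `OrbitAverages`), and cyclic rotation of a closed word (reversal and backtracks are pointwise facts of
  `WordLoop`); the plaquette word has `wordLoop = plaquetteTrace` (`Targets`).

All invariances are those of the tree (`wilsonExpectation_comp_torusConfigShift`,
`wilsonExpectation_comp_configPerm`, `WilsonSiteRP.measurePreserving_negReflect`); this file only transports them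
to words. No loop equation and no certificate is here.
-/

noncomputable section

open MeasureTheory
open Literature.MathematicalPhysics.QuantumFieldTheory
open Literature.RepresentationTheory.CompactGroups

namespace Summit.QuantumFields.GaugeBoot

/-! ## Symmetries acting on steps and words -/

namespace Step

variable {d : ℕ}

/-- Relabelling of the axes by a permutation `π`: `±e_μ ↦ ±e_{π μ}`. [folklore] -/
def permute (π : Equiv.Perm (Fin d)) : Step d → Step d
  | fwd μ => fwd (π μ)
  | bwd μ => bwd (π μ)

/-- The reflection of axis `0`: `±e₀ ↦ ∓e₀`, other steps unchanged. [folklore] -/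
def reflect0 [NeZero d] : Step d → Step d
  | fwd μ => if μ = 0 then bwd μ else fwd μ
  | bwd μ => if μ = 0 then fwd μ else bwd μ

/-- `permute` on a forward step. [folklore] -/
@[simp] theorem permute_fwd (π : Equiv.Perm (Fin d)) (μ : Fin d) : (fwd μ : Step d).permute π = fwd (π μ) := rfl

/-- `permute` on a backward step. [folklore] -/
@[simp] theorem permute_bwd (π : Equiv.Perm (Fin d)) (μ : Fin d) : (bwd μ : Step d).permute π = bwd (π μ) := rfl

/-- `permute` is an action. [folklore] -/
theorem permute_permute (π σ : Equiv.Perm (Fin d)) (s : Step d) :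
    (s.permute σ).permute π = s.permute (π * σ) := by
  cases s <;> rfl

/-- The identity permutation acts trivially. [folklore] -/
@[simp] theorem permute_one (s : Step d) : s.permute 1 = s := by cases s <;> rfl

/-- `π⁻¹ ∘ π` acts trivially on steps. [folklore] -/
@[simp] theorem permute_symm_permute (π : Equiv.Perm (Fin d)) (s : Step d) :
    (s.permute π).permute π.symm = s := by
  cases s <;> simp [permute]

/-- `π ∘ π⁻¹` acts trivially on steps. [folklore] -/
@[simp] theorem permute_permute_symm (π : Equiv.Perm (Fin d)) (s : Step d) :
    (s.permute π.symm).permute π = s := by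
  cases s <;> simp [permute]

/-- `reflect0` is an involution. [folklore] -/
@[simp] theorem reflect0_reflect0 [NeZero d] (s : Step d) : s.reflect0.reflect0 = s := by
  cases s with
  | fwd μ => by_cases h : μ = 0 <;> simp [reflect0, h]
  | bwd μ => by_cases h : μ = 0 <;> simp [reflect0, h]

/-- `permute` commutes with `inv`. [folklore] -/
theorem inv_permute (π : Equiv.Perm (Fin d)) (s : Step d) : (s.permute π).inv = s.inv.permute π := by
  cases s <;> rfl

/-- `reflect0` commutes with `inv`. [folklore] -/
theorem inv_reflect0 [NeZero d] (s : Step d) : s.reflect0.inv = s.inv.reflect0 := by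
  cases s with
  | fwd μ => by_cases h : μ = 0 <;> simp [reflect0, inv, h]
  | bwd μ => by_cases h : μ = 0 <;> simp [reflect0, inv, h]

end Step

/-! ## Equivariance of word holonomies -/

section Holonomy

variable {d L : ℕ} {G : Type*} [Group G]

open TorusTranslation

/-- Word holonomies of a translated configuration: `hol_x(w)(τ_v U) = hol_{x-v}(w)(U)`. [folklore] -/
theorem wordHolonomy_torusConfigShift [MeasurableSpace G] (v : Site d L) (U : GaugeConfig d L G) :
    ∀ (w : Word d) (x : Site d L), wordHolonomy (torusConfigShift v U) x w = wordHolonomy U (x - v) w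
  | [], x => by simp
  | s :: w, x => by
    rw [wordHolonomy_cons, wordHolonomy_cons, wordHolonomy_torusConfigShift v U w]
    cases s with
    | fwd μ =>
      simp only [stepHolonomy_fwd, torusConfigShift_apply, Step.apply_fwd, Site.shift, add_sub_right_comm]
    | bwd μ =>
      simp only [stepHolonomy_bwd, torusConfigShift_apply, Step.apply_bwd, sub_right_comm]

omit [Group G] in
/-- `sitePerm` is compatible with subtraction of a unit vector. [folklore] -/
theorem sitePerm_sub_single (π : Equiv.Perm (Fin d)) (x : Site d L) (μ : Fin d) :
    sitePerm π (x - Pi.single μ 1) = sitePerm π x - Pi.single (π μ) 1 := by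
  rw [sub_eq_add_neg, ← Pi.single_neg, sitePerm_add, sitePerm_single, Pi.single_neg, ← sub_eq_add_neg]

/-- Word holonomies of an axis-permuted configuration:
`hol_x(w)(π·U) = hol_{π⁻¹x}(π⁻¹·w)(U)`. [folklore] -/
theorem wordHolonomy_configPerm [MeasurableSpace G] (π : Equiv.Perm (Fin d)) (U : GaugeConfig d L G) :
    ∀ (w : Word d) (x : Site d L), wordHolonomy (configPerm π U) x w =
      wordHolonomy U (sitePerm π.symm x) (w.map (Step.permute π.symm))
  | [], x => by simp
  | s :: w, x => by
    rw [List.map_cons, wordHolonomy_cons, wordHolonomy_cons, wordHolonomy_configPerm π U w]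
    cases s with
    | fwd μ =>
      simp only [stepHolonomy_fwd, configPerm_apply, Step.permute_fwd, Step.apply_fwd, sitePerm_shift]
    | bwd μ =>
      simp only [stepHolonomy_bwd, configPerm_apply, Step.permute_bwd, Step.apply_bwd, sitePerm_sub_single]

variable [NeZero d]

open WilsonSiteRP in
/-- Reflecting the endpoint of a step = stepping the reflected step from the reflected site. [folklore] -/
theorem negReflect_apply_step (x : Site d L) (s : Step d) :
    (s.apply x).negReflect = s.reflect0.apply x.negReflect := by
  have hzero : (x.shift (0 : Fin d)).negReflect = x.negReflect - Pi.single 0 1 :=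
    eq_sub_of_add_eq (negReflect_shift_shift x)
  cases s with
  | fwd μ =>
    by_cases hμ : μ = 0
    · subst hμ; simp [Step.reflect0, hzero]
    · simp [Step.reflect0, hμ, negReflect_shift_of_ne x hμ]
  | bwd μ =>
    by_cases hμ : μ = 0
    · subst hμ
      have h := eq_sub_of_add_eq (negReflect_shift_shift (x - Pi.single (0 : Fin d) 1))
      simp only [Site.shift, sub_add_cancel] at h
      have h' : (x - Pi.single (0 : Fin d) 1).negReflect = x.negReflect + Pi.single 0 1 :=
        eq_add_of_sub_eq h.symm
      simp [Step.reflect0, h', Site.shift]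
    · have h := negReflect_shift_of_ne (x - Pi.single μ 1) hμ
      simp only [Site.shift, sub_add_cancel] at h
      have h' : (x - Pi.single μ 1).negReflect = x.negReflect - Pi.single μ 1 := eq_sub_of_add_eq h.symm
      simp [Step.reflect0, hμ, h']

open WilsonSiteRP in
/-- One step of the reflected configuration. [folklore] -/
theorem stepHolonomy_negReflect (U : GaugeConfig d L G) (x : Site d L) (s : Step d) :
    stepHolonomy U.negReflect x s = stepHolonomy U x.negReflect s.reflect0 := by
  have hzero : (x.shift (0 : Fin d)).negReflect = x.negReflect - Pi.single 0 1 :=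
    eq_sub_of_add_eq (negReflect_shift_shift x)
  cases s with
  | fwd μ =>
    by_cases hμ : μ = 0
    · subst hμ
      simp [Step.reflect0, GaugeConfig.negReflect, hzero]
    · simp [Step.reflect0, GaugeConfig.negReflect, hμ]
  | bwd μ =>
    by_cases hμ : μ = 0
    · subst hμ
      have h : (x - Pi.single (0 : Fin d) 1).shift 0 = x := by simp [Site.shift]
      simp [Step.reflect0, GaugeConfig.negReflect, h]
    · have h := negReflect_shift_of_ne (x - Pi.single μ 1) hμ
      simp only [Site.shift, sub_add_cancel] at h
      have h' : (x - Pi.single μ 1).negReflect = x.negReflect - Pi.single μ 1 := eq_sub_of_add_eq h.symm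
      simp [Step.reflect0, GaugeConfig.negReflect, hμ, h']

/-- Word holonomies of the reflected configuration: `hol_x(w)(Θ'U) = hol_{θ'x}(θ'·w)(U)`. [folklore] -/
theorem wordHolonomy_negReflect (U : GaugeConfig d L G) :
    ∀ (w : Word d) (x : Site d L),
      wordHolonomy U.negReflect x w = wordHolonomy U x.negReflect (w.map Step.reflect0)
  | [], x => by simp
  | s :: w, x => by
    rw [List.map_cons, wordHolonomy_cons, wordHolonomy_cons, stepHolonomy_negReflect,
      wordHolonomy_negReflect U w, negReflect_apply_step]

end Holonomy

/-! ## The loop variable of a word and the invariances of its torus expectation -/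

section LoopVariable

variable {d L N : ℕ} {G : Type*} [Group G] [TopologicalSpace G] [IsTopologicalGroup G]
  [CompactSpace G] [MeasurableSpace G] [BorelSpace G] (ρ : G →* Matrix (Fin N) (Fin N) ℂ)

omit [TopologicalSpace G] [IsTopologicalGroup G] [CompactSpace G] [MeasurableSpace G] [BorelSpace G] in
/-- The plaquette word has the plaquette trace as its loop variable. [folklore] -/
theorem wordLoop_plaquette (x : Site d L) (i j : Fin d) :
    wordLoop ρ x (Word.plaquette i j) = plaquetteTrace (G := G) ρ x i j := by
  funext U
  simp only [wordLoop, plaquetteTrace, wordHolonomy_plaquette]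

variable [NeZero L]

open TorusTranslation in
/-- **Translation invariance**: `⟨W_x(w)⟩ = ⟨W_y(w)⟩` for all base points (tree
`wilsonExpectation_comp_torusConfigShift`). [folklore] -/
theorem wilsonExpectation_wordLoop_translate (β : ℝ) (x y : Site d L) (w : Word d) :
    wilsonExpectation ρ β (wordLoop (G := G) ρ x w) = wilsonExpectation ρ β (wordLoop ρ y w) := by
  have h := wilsonExpectation_comp_torusConfigShift (d := d) (L := L) (G := G) ρ β (y - x) (wordLoop ρ y w)
  have h' : (wordLoop ρ y w ∘ torusConfigShift (y - x) : GaugeConfig d L G → ℝ) = wordLoop ρ x w := by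
    funext U; simp only [Function.comp_apply, wordLoop, wordHolonomy_torusConfigShift, sub_sub_cancel]
  rw [h'] at h
  exact h

/-- **Axis-permutation invariance**: `⟨W_x(w)⟩ = ⟨W_{πx}(π·w)⟩` (tree `wilsonExpectation_comp_configPerm`,
continuous `ρ`). [folklore] -/
theorem wilsonExpectation_wordLoop_permute (hρ : Continuous ρ) (β : ℝ) (π : Equiv.Perm (Fin d))
    (x : Site d L) (w : Word d) :
    wilsonExpectation ρ β (wordLoop (G := G) ρ x w) =
      wilsonExpectation ρ β (wordLoop ρ (sitePerm π x) (w.map (Step.permute π))) := by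
  have h := wilsonExpectation_comp_configPerm (d := d) (L := L) (G := G) ρ hρ β π
    (wordLoop ρ (sitePerm π x) (w.map (Step.permute π)))
  have hx : sitePerm π.symm (sitePerm π x) = x := by funext k; simp
  have hw : (w.map (Step.permute π)).map (Step.permute π.symm) = w := by
    rw [List.map_map]
    conv_rhs => rw [← List.map_id w]
    exact List.map_congr_left fun s _ => by simp
  have h' : (wordLoop ρ (sitePerm π x) (w.map (Step.permute π)) ∘ configPerm π : GaugeConfig d L G → ℝ) =
      wordLoop ρ x w := by
    funext U
    simp only [Function.comp_apply, wordLoop, wordHolonomy_configPerm, hx, hw]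
  rw [h'] at h
  exact h

/-- **Reflection invariance** (every torus side `L`; `wilsonExpectation_comp_negReflect`):
`⟨W_x(w)⟩ = ⟨W_{θ'x}(θ'·w)⟩` for the reflection `θ'` of axis `0`. [folklore] -/
theorem wilsonExpectation_wordLoop_reflect0 [NeZero d] (hρ : Continuous ρ) (β : ℝ) (x : Site d L) (w : Word d) :
    wilsonExpectation ρ β (wordLoop (G := G) ρ x w) =
      wilsonExpectation ρ β (wordLoop ρ x.negReflect (w.map Step.reflect0)) := by
  have h := wilsonExpectation_comp_negReflect (d := d) (L := L) (G := G) ρ hρ β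
    (wordLoop ρ x.negReflect (w.map Step.reflect0))
  have hw : (w.map Step.reflect0).map Step.reflect0 = w := by
    rw [List.map_map]
    conv_rhs => rw [← List.map_id w]
    exact List.map_congr_left fun s _ => by simp
  have h' : (wordLoop ρ x.negReflect (w.map Step.reflect0) ∘ GaugeConfig.negReflect : GaugeConfig d L G → ℝ) =
      wordLoop ρ x w := by
    funext U
    simp only [Function.comp_apply, wordLoop, wordHolonomy_negReflect, WilsonSiteRP.negReflect_negReflect, hw]
  rw [h'] at h
  exact h

/-- **Cyclic invariance** for closed words: `⟨W_x(s · w)⟩ = ⟨W_x(w · s)⟩` (rotation + translation of the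
base point). [folklore] -/
theorem wilsonExpectation_wordLoop_rotate (β : ℝ) (x : Site d L) (s : Step d) (w : Word d)
    (hw : Word.endpoint x (s :: w) = x) :
    wilsonExpectation ρ β (wordLoop (G := G) ρ x (s :: w)) = wilsonExpectation ρ β (wordLoop ρ x (w ++ [s])) := by
  rw [wordLoop_rotate ρ x s w hw, wilsonExpectation_wordLoop_translate ρ β (s.apply x) x]

end LoopVariable

end Summit.QuantumFields.GaugeBoot

end
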